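import Summits.HodgeConjecture.HodgeConjecture.Theorems.MarkmanPartnerTransportK3Sq2BettiTwoHodgeStructure
import Summits.HodgeConjecture.HodgeConjecture.Theorems.MarkmanPartnerTransportOrphanKSCore
import Literature.AlgebraicGeometry.Hyperkaehler.K3HilbertTypePicardRankEighteenHodge
import Literature.AlgebraicGeometry.Motives.KugaSatakePolarizationProofs

/-!
# Route MarkmanPartnerTransport · crux `LowPicardRealMultiplication` (stmt-HodgeConjecture-19653) —
# the transcendental part of a MARKED `K3^{[2]}`-type fourfold PRESENTED (`IsTranscendentalPartHK` inhabited),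
# and HC for ALL POWERS of `K3^{[2]}`-type fourfolds of Picard rank `≥ 18`

For a smooth projective fourfold `X` marked by `(φ, P, z)` ((m1)–(m6)), `…K3Sq2BettiTwoHodgeStructure` gives the
rational Beauville–Bogomolov form `q_B` and THE transcendental part `T(X)_ℚ = Hdg¹^{⊥ q_B} ⊆ H²_B(X)`. Here:
* `exists_polarization_negRatBBF` — **`−q_B` POLARIZES `T(X)_ℚ`**: `F^p ⊥ F^{3−p}`; positivity
  `i^{p−q}(−q_B)(x, x̄) > 0` on `T^{p,q} ∖ 0` — `|t|² q(z, z̄) > 0` on `(2,0)`/`(0,2)` ((m6)), and on `(1,1)` the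
  HODGE INDEX for `q` (`BBFPositivity.k3HilbertForm_self_neg_of_oneOne_of_kaehler_orthogonal`; `T ⊥ κ` as `κ ∈ Hdg¹`;
  `−q(w, w̄) = −(q(a,a) + q(b,b))/4` for the real parts `a = w + w̄`, `b = i(w − w̄)` of `w ∈ T^{1,1}`);
* `exists_isTranscendentalPartHK` — **THE PRESENTATION**: for the Fujiki form `b = −q ∘ (φ × φ)` and the real
  Hodge model, `(T(X)_ℚ, −q_B|_T, T ↪ H²_B(X))` satisfies `IsTranscendentalPartHK` — the `∀ (b, M, T, H, P, j)`
  binder of the Kuga–Satake predicate `IsKSCorrespondenceAlgebraicHK 2` and of Varesco's Cor. 4.6 record is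
  INHABITED for every marked `K3^{[2]}`-type fourfold (vacuity screen), with `dim_ℚ T = 23 − ρ(X)`;
* `hodgeConjectureFor_powers_of_eighteen_le` — **consumer: for every marked smooth projective `K3^{[2]}`-type
  fourfold with `ρ(X) ≥ 18`, the Hodge conjecture holds for `X` AND FOR ALL POWERS `X^{m+1}`**, by the Literature
  theorem `hodgeConjectureFor_powers_k3HilbertType_of_finrank_transcendental_le_five` (Floccari–Fu 2026 Thm. 13.2 (i)
  / Cor. 13.4 + their Weil-fourfold theorem + Arapura L. 4.2 + Huybrechts 1999 signature, BY NAME), whose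
  presentation hypothesis is now supplied. CONDITIONAL on those four named facts (the first a PREPRINT record).

THEOREMS ONLY; no definition, no new named fact, no sorry; nothing here says HC or any crux is proved.
Prover seat hodge-nonav-19652-p1 (gen 15), `--supports stmt-HodgeConjecture-19653`. References: Beauville, JDG 18 (1983) §8 Thm. 5; Huybrechts, Invent. Math. 135 (1999) §1.9–1.11, *Lectures on
K3 Surfaces* Ch. 3 Lemma 3.1; Voisin, *Hodge Theory I* Thm. 6.32; Floccari–Fu, arXiv:2607.07528 Thm. 13.2 (i).
-/

set_option linter.dupNamespace false

noncomputable section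

namespace Summit.HodgeConjecture.HodgeConjecture.Theorems.MarkmanPartnerTransport.KugaSatakeHK

open scoped TensorProduct ComplexConjugate
open CategoryTheory Literature.AlgebraicGeometry Literature.AlgebraicGeometry.Motives
open Literature.AlgebraicGeometry.HodgeTheory Literature.AlgebraicTopology.SingularHomology
open Literature.AlgebraicGeometry.Motives.HodgeStructure Literature.AlgebraicGeometry.Hyperkaehler
open Literature.AlgebraicGeometry.Surfaces Literature.Geometry.Kaehler
open Summit.HodgeConjecture.HodgeConjecture.Theorems.NikulinTwinTransport
open Summit.HodgeConjecture.HodgeConjecture.Theorems.MarkmanPartnerTransport.BBFPositivity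
open Summit.HodgeConjecture.HodgeConjecture.Theorems.MarkmanPartnerTransport.PartnerLattice

variable {X : SchemeOver ℂ} {φ : complexBetti X 2 ≃ₗ[ℂ] (K3HilbertIndex → ℂ)} {P : complexBetti X (2 * 4)}
  {z : K3HilbertIndex → ℂ}

/-- `MarkedK3Sq[X, φ, P, z]`: VERBATIM the `let MarkedK3Sq := …` binder of the route declarations of
MarkmanPartnerTransport (clauses (m1)–(m6)). Local notation only. -/
local notation3 (prettyPrint := false) "MarkedK3Sq[" X ", " φ ", " P ", " z "]" =>
  (((IsIntegralClass P ∧ ∀ Q : complexBetti X (2 * 4), IsIntegralClass Q → ∃ n : ℤ, Q = n • P) ∧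
    (∀ c : complexBetti X 2, IsIntegralClass c ↔ ∃ v : K3HilbertIndex → ℤ, φ c = fun i => (v i : ℂ)) ∧
    (∀ a : complexBetti X 2, cupPowTwo a 4 = ((3 : ℂ) * (k3HilbertForm 2 (φ a) (φ a)) ^ 2) • P) ∧
    (IsOfHodgeType 4 X 2 2 0 (LinearEquiv.symm φ z) ∧
      ∀ τ : complexBetti X 2, IsOfHodgeType 4 X 2 2 0 τ → ∃ t : ℂ, τ = t • LinearEquiv.symm φ z) ∧
    (∀ c : complexBetti X 2, IsOfHodgeType 4 X 2 1 1 c ↔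
      (k3HilbertForm 2 (φ c) z = 0 ∧ k3HilbertForm 2 (φ c) (star z) = 0)) ∧
    (k3HilbertForm 2 z z = 0 ∧ 0 < (k3HilbertForm 2 (star z) z).re)))

/-- `qC` = the complex Beauville–Bogomolov form on `ℂ²³`. Local notation only. -/
local notation3 (prettyPrint := false) "qC" => Matrix.toBilin' (Matrix.map (k3HilbertGram 2) (Int.cast : ℤ → ℂ))

/-- `H²_B[hX]`: the weight-two `ℚ`-Hodge structure on `H²(X(ℂ); ℚ)` of the real Hodge model of `X`. -/
local notation3 "H²_B[" hX "]" =>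
  bettiTwoHodgeStructureOfModel hX (BettiUniverse.realHodgeModel exists_isReal_hodgeModel_holds hX)
    (BettiUniverse.realHodgeModel_isHodgeSymmetric exists_isReal_hodgeModel_holds hX)

/-- `Θ : ℂ ⊗_ℚ H²(X(ℂ); ℚ) → H²(X(ℂ); ℂ)`. -/
local notation3 "Θ[" X "]" => ofRatClassBaseChange (Motives.ComplexPoints X) (2 * 1)
/-- `ι : H²(X(ℂ); ℚ) → H²(X(ℂ); ℂ)`, the rational lattice. -/
local notation3 "ι[" X "]" => ofRatClass (Motives.ComplexPoints X) (2 * 1)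

/-! ### §1 Small lemmas: reality, the `(2,0)`-value, the Kähler class in `Hdg¹` -/

/-- Subtractivity of `q` in the first slot. [folklore] -/
theorem bbf_sub_left (u u' v : K3HilbertIndex → ℂ) :
    k3HilbertForm 2 (u - u') v = k3HilbertForm 2 u v - k3HilbertForm 2 u' v := by
  rw [← qC_apply, LinearMap.map_sub₂, qC_apply, qC_apply]

/-- Subtractivity of `q` in the second slot. [folklore] -/
theorem bbf_sub_right (u v v' : K3HilbertIndex → ℂ) :
    k3HilbertForm 2 u (v - v') = k3HilbertForm 2 u v - k3HilbertForm 2 u v' := by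
  rw [← qC_apply, map_sub, qC_apply, qC_apply]

/-- `q(z, z̄)` as a positive real: `q(z, z̄) = q(z̄, z) = r` with `r = Re q(z̄, z) > 0` under (m6). [folklore] -/
theorem bbf_period_conj_eq_ofReal (hzpos : 0 < (k3HilbertForm 2 (star z) z).re) :
    k3HilbertForm 2 z (star z) = (((k3HilbertForm 2 (star z) z).re : ℝ) : ℂ) ∧
      0 < (k3HilbertForm 2 (star z) z).re := by
  refine ⟨Complex.ext ?_ ?_, hzpos⟩
  · rw [k3HilbertForm_comm, Complex.ofReal_re]
  · rw [Complex.ofReal_im]; exact k3HilbertForm_self_star_im z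

/-- `ι k` is a real class: `conjClass (k ⊗ 1) = k ⊗ 1`. [cite: VoisinHodgeI2002, Cor. 6.12] -/
theorem conjClass_ofRatClass_eq (hX : IsSmoothProjective (2 * 2) X) (k : bettiCohomology X (2 * 1)) :
    conjClass _ (2 * 1) (ι[X] k) = ι[X] k := by
  have h := ofRatClassBaseChange_conj_eq₄ hX ((1 : ℂ) ⊗ₜ[ℚ] k)
  rw [conj_tmul, map_one, ofRatClassBaseChange_tmul, one_smul] at h
  exact h.symm

/-! ### §2 `−q_B` polarizes the transcendental part -/

/-- **`−q_B|_T` is a polarization of the transcendental part `T(X)_ℚ`** of a marked `X` (Hodge–Riemann for the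
Beauville–Bogomolov form on `T`: `q(σ, σ̄) > 0`, and `q` NEGATIVE definite on the real `(1,1)`-classes of `T`,
which are `q`-orthogonal to the Kähler class — Beauville–Fujiki positivity + Hodge index, file
`…PartnerExistenceBBFPositivity`). [cite: Beauville1983, §8 Thm. 5] [cite: VoisinHodgeI2002, Thm. 6.32 and §7.1.2]
[cite: Huybrechts2016K3, Ch. 3 Lemma 3.1] -/
theorem exists_polarization_negRatBBF (hX : IsSmoothProjective (2 * 2) X) (hM : MarkedK3Sq[X, φ, P, z])
    {qB : LinearMap.BilinForm ℚ (bettiCohomology X (2 * 1))} (hsymm : qB.IsSymm)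
    (hqB : ∀ a b, ((qB a b : ℚ) : ℂ) = k3HilbertForm 2 (φ (ι[X] a)) (φ (ι[X] b)))
    (T : SubHodgeStructure (H²_B[hX])) (hT : T.toSubmodule = qB.orthogonal ((H²_B[hX]).hodgeClasses 1)) :
    ∃ Pol : T.toHodgeStructure.Polarization,
      Pol.form = ((-1 : ℤ) : ℚ) • qB.compl₁₂ T.toSubmodule.subtype T.toSubmodule.subtype := by
  classical
  obtain ⟨-, hint, -, ⟨h20, hline⟩, h11, hzz, hzpos⟩ := id hM
  have hK3 := isOfK3Type_bettiTwoHK hX hM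
  obtain ⟨D⟩ := nonempty_kaehlerRationalDatum hX
  set M := BettiUniverse.realHodgeModel exists_isReal_hodgeModel_holds hX with hMdef
  have hMs := BettiUniverse.realHodgeModel_isHodgeSymmetric exists_isReal_hodgeModel_holds hX
  have hI := hodgePQ_independent_of_hodgeModel_holds
  -- the Kähler class is `ι k` with `k ∈ Hdg¹`, so `T ⊥ κ`
  obtain ⟨k, hk⟩ := (isRationalClass_iff_mem_range_ofRatClass _).1 D.isRationalClass_Hη
  have hkH : k ∈ (H²_B[hX]).hodgeClasses 1 := by
    rw [bettiTwoHodgeStructureOfModel, cast_hodgeClasses]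
    exact (M.mem_hodgeClasses_iff_isOfHodgeType hX hI hMs 1 k).2 (hk ▸ D.isOfHodgeType_Hη)
  have hTκ : ∀ x : ℂ ⊗[ℚ] T.toSubmodule,
      k3HilbertForm 2 (φ D.Hη) (φ (Θ[X] (T.toSubmodule.subtype.baseChange ℂ x))) = 0 := by
    intro x
    induction x using TensorProduct.induction_on with
    | zero => rw [map_zero, map_zero, map_zero, bbf_zero_right]
    | tmul c t =>
      rw [LinearMap.baseChange_tmul, Submodule.subtype_apply, ofRatClassBaseChange_tmul, map_smul, bbf_smul_right,
        ← hk, ← hqB]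
      have ht : (t : bettiCohomology X (2 * 1)) ∈ qB.orthogonal ((H²_B[hX]).hodgeClasses 1) := hT ▸ t.2
      rw [LinearMap.BilinForm.mem_orthogonal_iff] at ht
      have h0 : qB k t = 0 := ht k hkH
      rw [h0, Rat.cast_zero, mul_zero]
    | add x y hx hy => rw [map_add, map_add, map_add, bbf_add_right, hx, hy, add_zero]
  refine ⟨{ form := ((-1 : ℤ) : ℚ) • qB.compl₁₂ T.toSubmodule.subtype T.toSubmodule.subtype
            flip_form := ?_
            form_apply_eq_zero := ?_
            pos := ?_ }, rfl⟩
  · have h2 : (2 : ℤ).negOnePow = 1 := by decide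
    rw [h2, Units.val_one, one_smul]
    refine LinearMap.ext fun x => LinearMap.ext fun y => ?_
    simp only [LinearMap.BilinForm.flip_apply, LinearMap.smul_apply, LinearMap.compl₁₂_apply, Submodule.subtype_apply]
    rw [hsymm.eq]
  · intro p x hx y hy
    rw [SubHodgeStructure.toHodgeStructure_F, Submodule.mem_comap] at hx hy
    rw [baseChange_smul_apply, baseChange_compl₁₂,
      ratBBF_F_apply_eq_zero hX hM hqB p _ hx _ (by convert hy using 2; ring), mul_zero]
  · intro p q hpq x hx hx0
    rw [SubHodgeStructure.mem_piece_iff] at hx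
    set y := T.toSubmodule.subtype.baseChange ℂ x with hy
    have hy0 : y ≠ 0 := fun h => hx0 (baseChange_injective_of_injective T.toSubmodule.injective_subtype (by rw [← hy, h, map_zero]))
    have hΘy0 : Θ[X] y ≠ 0 := fun h => hy0 (ofRatClassBaseChange_injective _ _ (by rw [h, map_zero]))
    obtain ⟨hr_eq, hr_pos⟩ := bbf_period_conj_eq_ofReal (z := z) hzpos
    set r : ℝ := (k3HilbertForm 2 (star z) z).re with hrdef
    rw [baseChange_smul_apply, baseChange_compl₁₂, ← conj_baseChange, ← hy, ratBBF_baseChange hqB,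
      ofRatClassBaseChange_conj_eq₄ hX]
    -- which piece?
    have hcases : p = 2 ∨ p = 1 ∨ p = 0 ∨ 2 < |p - q| := by
      rcases le_or_gt 3 p with h | h
      · right; right; right; rw [abs_of_nonneg (by omega)]; omega
      · rcases lt_or_ge p 0 with h' | h'
        · right; right; right; rw [abs_of_neg (by omega)]; omega
        · omega
    rcases hcases with rfl | rfl | rfl | hfar
    · -- `(2,0)`: `Θy = t φ⁻¹ z`
      obtain rfl : q = 0 := by omega
      obtain ⟨t, ht⟩ := hline _ ((mem_pieceHK_two_zero_iff hX y).1 hx)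
      have ht0 : t ≠ 0 := by rintro rfl; rw [zero_smul] at ht; exact hΘy0 ht
      refine ⟨Complex.normSq t * r, mul_pos (Complex.normSq_pos.2 ht0) hr_pos, ?_⟩
      have hI : Complex.I ^ (2 : ℤ) * (Complex.I ^ (0 : ℤ))⁻¹ = -1 := by
        rw [zpow_two, zpow_zero, inv_one, mul_one, Complex.I_mul_I]
      rw [ht, conjClass_smul, map_smul, map_smul, marking_conjClass hint, LinearEquiv.apply_symm_apply,
        HkLatticeWitt.k3HilbertForm_smul_left, bbf_smul_right, hr_eq, hI, Complex.ofReal_mul, ← Complex.mul_conj]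
      push_cast
      ring
    · -- `(1,1)`: Hodge index on the real parts
      obtain rfl : q = 1 := by omega
      have hw11 : IsOfHodgeType 4 X (2 * 1) 1 1 (Θ[X] y) := (mem_pieceHK_one_one_iff hX y).1 hx
      set w := Θ[X] y with hw
      -- conjugate: also `(1,1)` and in `T_ℂ`
      have hwbar_eq : conjClass _ (2 * 1) w = Θ[X] (T.toSubmodule.subtype.baseChange ℂ (HodgeStructure.conj x)) := by
        rw [hw, hy, ← ofRatClassBaseChange_conj_eq₄ hX, conj_baseChange]
      have h11bar : ∀ c : complexBetti X 2, IsOfHodgeType 4 X 2 1 1 c → IsOfHodgeType 4 X 2 1 1 (conjClass _ (2 * 1) c) := by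
        intro c hc
        obtain ⟨h1, h2⟩ := (h11 c).1 hc
        refine (h11 _).2 ⟨?_, ?_⟩
        · rw [marking_conjClass hint, ← star_star z, ← star_k3HilbertForm, h2, star_zero]
        · rw [marking_conjClass hint, ← star_k3HilbertForm, h1, star_zero]
      -- real and imaginary parts
      set a := w + conjClass _ (2 * 1) w with ha
      set b := Complex.I • (w - conjClass _ (2 * 1) w) with hb
      have hareal : conjClass _ (2 * 1) a = a := by
        rw [ha, conjClass_add, conjClass_conjClass, add_comm]
      have hcsub : ∀ c c' : complexBetti X 2,
          conjClass _ (2 * 1) (c - c') = conjClass _ (2 * 1) c - conjClass _ (2 * 1) c' := by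
        intro c c'
        rw [sub_eq_add_neg, conjClass_add, ← neg_one_smul ℂ c', conjClass_smul, map_neg, map_one, neg_one_smul,
          ← sub_eq_add_neg]
      have hbreal : conjClass _ (2 * 1) b = b := by
        rw [hb, conjClass_smul, hcsub, conjClass_conjClass, Complex.conj_I, neg_smul, ← smul_neg, neg_sub]
      have ha11 : IsOfHodgeType 4 X 2 1 1 a := by rw [ha]; exact IsOfHodgeType.add hX hw11 (h11bar _ hw11)
      have hb11 : IsOfHodgeType 4 X 2 1 1 b := by
        rw [hb]; exact (IsOfHodgeType.sub hX hw11 (h11bar _ hw11)).smul _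
      have hwκ : k3HilbertForm 2 (φ D.Hη) (φ w) = 0 := hTκ x
      have hwbarκ : k3HilbertForm 2 (φ D.Hη) (φ (conjClass _ (2 * 1) w)) = 0 := by
        rw [hwbar_eq]; exact hTκ _
      have haκ : k3HilbertForm 2 (φ D.Hη) (φ a) = 0 := by rw [ha, map_add, bbf_add_right, hwκ, hwbarκ, add_zero]
      have hbκ : k3HilbertForm 2 (φ D.Hη) (φ b) = 0 := by
        rw [hb, map_smul, bbf_smul_right, map_sub, bbf_sub_right, hwκ, hwbarκ, sub_zero, mul_zero]
      -- `4 q(w, w̄) = q(a, a) + q(b, b)`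
      have hwa : (2 : ℂ) • w = a - Complex.I • b := by
        rw [ha, hb, smul_smul, Complex.I_mul_I, neg_smul, one_smul, sub_neg_eq_add, two_smul]; abel
      have hwb : (2 : ℂ) • conjClass _ (2 * 1) w = a + Complex.I • b := by
        rw [ha, hb, smul_smul, Complex.I_mul_I, neg_smul, one_smul, two_smul]; abel
      have hkey : (4 : ℂ) * k3HilbertForm 2 (φ w) (φ (conjClass _ (2 * 1) w)) =
          k3HilbertForm 2 (φ a) (φ a) + k3HilbertForm 2 (φ b) (φ b) := by
        have h4 : (4 : ℂ) * k3HilbertForm 2 (φ w) (φ (conjClass _ (2 * 1) w)) =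
            k3HilbertForm 2 (φ ((2 : ℂ) • w)) (φ ((2 : ℂ) • conjClass _ (2 * 1) w)) := by
          rw [map_smul, map_smul, HkLatticeWitt.k3HilbertForm_smul_left, bbf_smul_right]; ring
        rw [h4, hwa, hwb]
        simp only [map_sub, map_add, map_smul]
        rw [bbf_sub_left, bbf_add_right, bbf_add_right, HkLatticeWitt.k3HilbertForm_smul_left,
          HkLatticeWitt.k3HilbertForm_smul_left, bbf_smul_right, bbf_smul_right, k3HilbertForm_comm 2 (φ b) (φ a)]
        linear_combination (-k3HilbertForm 2 (φ b) (φ b)) * Complex.I_mul_I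
      -- signs of `q(a,a)`, `q(b,b)`
      have hqa : (k3HilbertForm 2 (φ a) (φ a)).re ≤ 0 ∧ (k3HilbertForm 2 (φ a) (φ a)).im = 0 ∧
          (a ≠ 0 → (k3HilbertForm 2 (φ a) (φ a)).re < 0) := by
        by_cases ha0 : a = 0
        · have h0 : k3HilbertForm 2 (φ a) (φ a) = 0 := by rw [ha0, map_zero, bbf_zero_left]
          exact ⟨by rw [h0, Complex.zero_re], by rw [h0, Complex.zero_im], fun h => absurd ha0 h⟩
        · obtain ⟨h1, h2⟩ := k3HilbertForm_self_neg_of_oneOne_of_kaehler_orthogonal hX hM D ha11 hareal ha0 haκ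
          exact ⟨h1.le, h2, fun _ => h1⟩
      have hqb : (k3HilbertForm 2 (φ b) (φ b)).re ≤ 0 ∧ (k3HilbertForm 2 (φ b) (φ b)).im = 0 ∧
          (b ≠ 0 → (k3HilbertForm 2 (φ b) (φ b)).re < 0) := by
        by_cases hb0 : b = 0
        · have h0 : k3HilbertForm 2 (φ b) (φ b) = 0 := by rw [hb0, map_zero, bbf_zero_left]
          exact ⟨by rw [h0, Complex.zero_re], by rw [h0, Complex.zero_im], fun h => absurd hb0 h⟩
        · obtain ⟨h1, h2⟩ := k3HilbertForm_self_neg_of_oneOne_of_kaehler_orthogonal hX hM D hb11 hbreal hb0 hbκ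
          exact ⟨h1.le, h2, fun _ => h1⟩
      have hab0 : a ≠ 0 ∨ b ≠ 0 := by
        by_contra h
        push Not at h
        apply hΘy0
        have h2w := hwa
        rw [h.1, h.2, smul_zero, sub_zero] at h2w
        exact (smul_eq_zero.1 h2w).resolve_left two_ne_zero
      set A := (k3HilbertForm 2 (φ a) (φ a)).re with hA
      set B := (k3HilbertForm 2 (φ b) (φ b)).re with hB
      have hsum : A + B < 0 := by
        rcases hab0 with h0 | h0
        · linarith [hqa.2.2 h0, hqb.1]
        · linarith [hqb.2.2 h0, hqa.1]
      refine ⟨-(A + B) / 4, by linarith, ?_⟩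
      have hval : k3HilbertForm 2 (φ w) (φ (conjClass _ (2 * 1) w)) = (((A + B) / 4 : ℝ) : ℂ) := by
        have hAc : k3HilbertForm 2 (φ a) (φ a) = ((A : ℝ) : ℂ) := Complex.ext (by simp [hA]) (by simp [hqa.2.1])
        have hBc : k3HilbertForm 2 (φ b) (φ b) = ((B : ℝ) : ℂ) := Complex.ext (by simp [hB]) (by simp [hqb.2.1])
        have h := hkey
        rw [hAc, hBc] at h
        have h4 : (4 : ℂ) ≠ 0 := by norm_num
        rw [Complex.ofReal_div, eq_div_iff (by norm_num : ((4 : ℝ) : ℂ) ≠ 0)]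
        push_cast at h ⊢
        linear_combination h
      rw [hval, zpow_one, mul_inv_cancel₀ Complex.I_ne_zero]
      push_cast
      ring
    · -- `(0,2)`: conjugate of `(2,0)`
      obtain rfl : q = 2 := by omega
      have hxbar : HodgeStructure.conj x ∈ T.toHodgeStructure.piece 2 0 := conj_mem_piece _ ((SubHodgeStructure.mem_piece_iff _).2 hx)
      rw [SubHodgeStructure.mem_piece_iff, ← conj_baseChange] at hxbar
      obtain ⟨t, ht⟩ := hline _ ((mem_pieceHK_two_zero_iff hX _).1 hxbar)
      rw [ofRatClassBaseChange_conj_eq₄ hX, ← hy] at ht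
      -- `Θ y = conj t • φ⁻¹ (star z)`
      have hyt : Θ[X] y = starRingEnd ℂ t • φ.symm (star z) := by
        have h := congrArg (conjClass _ (2 * 1)) ht
        rw [conjClass_conjClass, conjClass_smul] at h
        rw [h]
        congr 1
        apply φ.injective
        rw [marking_conjClass hint, LinearEquiv.apply_symm_apply, LinearEquiv.apply_symm_apply]
      have ht0 : t ≠ 0 := by
        rintro rfl
        rw [map_zero, zero_smul] at hyt
        exact hΘy0 hyt
      refine ⟨Complex.normSq t * r, mul_pos (Complex.normSq_pos.2 ht0) hr_pos, ?_⟩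
      have hI : Complex.I ^ (0 : ℤ) * (Complex.I ^ (2 : ℤ))⁻¹ = -1 := by
        rw [zpow_zero, one_mul, zpow_two, Complex.I_mul_I, inv_neg, inv_one]
      rw [ht, hyt, map_smul, map_smul, LinearEquiv.apply_symm_apply, LinearEquiv.apply_symm_apply,
        HkLatticeWitt.k3HilbertForm_smul_left, bbf_smul_right, k3HilbertForm_comm 2 (star z) z, hr_eq, hI,
        Complex.ofReal_mul, ← Complex.mul_conj]
      push_cast
      ring
    · exfalso
      have hbot := hK3.2 p q hfar
      rw [hbot, Submodule.mem_bot] at hx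
      exact hy0 hx

/-! ### §3 The presentation -/

/-- **THE TRANSCENDENTAL PART OF A MARKED `K3^{[2]}`-TYPE FOURFOLD IS PRESENTED** (`IsTranscendentalPartHK`):
for `X` smooth projective with a marking `(φ, P, z)`, the Fujiki form `b = −q ∘ (φ × φ)`, the real Hodge model,
the transcendental part `T ⊆ H²_B(X)` (irreducible, K3 type, THE transcendental part) polarized by `−q_B|_T` and
`j = T ↪ H²_B(X)`: `IsTranscendentalPartHK hX M hM b T P j` holds, and `dim_ℚ T = 23 − ρ(X)`. The `∀`-binder of
`IsKSCorrespondenceAlgebraicHK 2` / of Varesco's Cor. 4.6 record is thus INHABITED (vacuity screen).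
[cite: Floccari2024, §5.1] [cite: Huybrechts2016K3, Ch. 3 Lemma 3.1] [cite: Varesco2023, §4 Rem. 4.3] -/
theorem exists_isTranscendentalPartHK (hX : IsSmoothProjective (2 * 2) X) (hM : MarkedK3Sq[X, φ, P, z]) :
    ∃ (b : complexBetti X 2 →ₗ[ℂ] complexBetti X 2 →ₗ[ℂ] ℂ) (T : SubHodgeStructure (H²_B[hX]))
      (Pol : T.toHodgeStructure.Polarization),
      IsFujikiForm 2 X b ∧ (∀ x y, b x y = -k3HilbertForm 2 (φ x) (φ y)) ∧
      T.toHodgeStructure.IsIrreducible ∧ T.toHodgeStructure.IsOfK3Type ∧ (H²_B[hX]).IsTranscendentalPart T ∧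
      Module.finrank ℚ T.toSubmodule + Module.finrank ℂ ↥(algebraicClasses X 1) = 23 ∧
      IsTranscendentalPartHK hX _ _ b T.toHodgeStructure Pol T.subtypeHom := by
  classical
  haveI : Module.Finite ℚ (bettiCohomology X (2 * 1)) := BettiUniverse.finite hX (2 * 1)
  obtain ⟨qB, T, hsymm, hnd, hqB, hT, htr, hirr, hK3T, -⟩ := exists_transcendental_subHodgeStructureHK hX hM
  obtain ⟨Pol, hPol⟩ := exists_polarization_negRatBBF hX hM hsymm hqB T hT
  obtain ⟨b₀, hb₀, hb₀q⟩ := OrphanKS.exists_isFujikiForm_marking hX hM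
  set M := BettiUniverse.realHodgeModel exists_isReal_hodgeModel_holds hX with hMdef
  have hMs := BettiUniverse.realHodgeModel_isHodgeSymmetric exists_isReal_hodgeModel_holds hX
  have hI := hodgePQ_independent_of_hodgeModel_holds
  -- `ρ(X) = dim Hdg¹`
  have hHdg : ∀ v : bettiCohomology X (2 * 1), v ∈ (H²_B[hX]).hodgeClasses 1 ↔ IsOfHodgeType 4 X (2 * 1) 1 1 (ι[X] v) := by
    intro v; rw [bettiTwoHodgeStructureOfModel, cast_hodgeClasses]; exact M.mem_hodgeClasses_iff_isOfHodgeType hX hI hMs 1 v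
  have hmap : (((H²_B[hX]).hodgeClasses 1).baseChange ℂ).map (Θ[X]) = algebraicClasses X 1 := by
    apply le_antisymm
    · rintro _ ⟨x, hx, rfl⟩
      obtain ⟨u, rfl⟩ := hx
      induction u using TensorProduct.induction_on with
      | zero => rw [map_zero, map_zero]; exact Submodule.zero_mem _
      | tmul c h =>
        rw [LinearMap.baseChange_tmul, Submodule.subtype_apply, ofRatClassBaseChange_tmul]
        exact Submodule.smul_mem _ c
          (lefschetzOneOne_rational_holds hX _ (isRationalClass_ofRatClass _) ((hHdg _).1 h.2))
      | add u₁ u₂ h₁ h₂ => rw [map_add, map_add]; exact Submodule.add_mem _ h₁ h₂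
    · change supportedClasses X (2 * 1) 1 ≤ _
      rw [supportedClasses_eq_span_isRationalClass hX (2 * 1) 1]
      refine Submodule.span_le.2 ?_
      rintro c ⟨hcQ, hcN⟩
      obtain ⟨a, rfl⟩ := (isRationalClass_iff_mem_range_ofRatClass c).1 hcQ
      have ha : a ∈ (H²_B[hX]).hodgeClasses 1 :=
        (hHdg a).2 (isOfHodgeType_of_mem_algebraicClasses_of_isSmoothProjective hX 1 hcN)
      exact ⟨(1 : ℂ) ⊗ₜ a, Submodule.tmul_mem_baseChange_of_mem 1 ha, by rw [ofRatClassBaseChange_tmul, one_smul]⟩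
  have hρ : Module.finrank ℚ ((H²_B[hX]).hodgeClasses 1) = Module.finrank ℂ (algebraicClasses X 1) := by
    set W := (H²_B[hX]).hodgeClasses 1
    have hinj := ofRatClassBaseChange_injective (Motives.ComplexPoints X) (2 * 1)
    rw [← hmap, ← (Submodule.equivMapOfInjective _ hinj (W.baseChange ℂ)).finrank_eq, Submodule.baseChange,
      LinearMap.finrank_range_of_inj (baseChange_injective_of_injective W.injective_subtype), Module.finrank_baseChange]
  have hdim : Module.finrank ℚ T.toSubmodule + Module.finrank ℂ ↥(algebraicClasses X 1) = 23 := by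
    rw [hT, LinearMap.BilinForm.finrank_orthogonal hnd, ← hρ, BettiUniverse.finrank_bettiCohomology_eq hX (2 * 1)]
    have h23 : Module.finrank ℂ (complexBetti X (2 * 1)) = 23 := by rw [φ.finrank_eq, finrank_complex23]
    have hle : Module.finrank ℚ ((H²_B[hX]).hodgeClasses 1) ≤ Module.finrank ℚ (bettiCohomology X (2 * 1)) :=
      Submodule.finrank_le _
    rw [BettiUniverse.finrank_bettiCohomology_eq hX (2 * 1)] at hle
    omega
  refine ⟨(-1 : ℂ) • b₀, T, Pol, hb₀.smul (neg_ne_zero.2 one_ne_zero), fun x y => ?_, hirr, hK3T, htr, hdim,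
    T.subtypeHom_injective, fun x => ?_, fun t t' => ?_⟩
  · rw [LinearMap.smul_apply, LinearMap.smul_apply, hb₀q, smul_eq_mul, neg_one_mul]
  · rw [SubHodgeStructure.subtypeHom_toLinearMap, Submodule.range_subtype, hT, LinearMap.BilinForm.mem_orthogonal_iff]
    refine forall₂_congr fun h hh => ?_
    change qB h x = 0 ↔ ((-1 : ℂ) • b₀) (ι[X] x) (ι[X] h) = 0
    rw [LinearMap.smul_apply, LinearMap.smul_apply, hb₀q, smul_eq_mul, neg_one_mul, neg_eq_zero, ← hqB, Rat.cast_eq_zero,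
      hsymm.eq]
  · rw [hPol]
    simp only [LinearMap.smul_apply, LinearMap.compl₁₂_apply, Submodule.subtype_apply, smul_eq_mul]
    push_cast
    rw [hqB, hb₀q]
    rfl

/-! ### §4 Consumer: all powers of `K3^{[2]}`-type fourfolds of Picard rank `≥ 18` -/

/-- **The Hodge conjecture for `X` AND ALL ITS POWERS, for every marked smooth projective `K3^{[2]}`-type fourfold
with `ρ(X) ≥ 18`** (`rank T(X) = 23 − ρ(X) ≤ 5`), by the Literature theorem
`hodgeConjectureFor_powers_k3HilbertType_of_finrank_transcendental_le_five` (Floccari–Fu 2026 Thm. 13.2 (i) / Cor. 13.4,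
their refereed Weil-fourfold theorem, Arapura 2006 L. 4.2 and Huybrechts' signature fact, BY NAME as hypotheses)
fed with the presentation `exists_isTranscendentalPartHK`. CONDITIONAL on those four records (the first a PREPRINT);
credits nothing to HC unconditionally. [cite: FloccariFu2026HyperKummer, Thm. 13.2 (i) and Cor. 13.4; PREPRINT]
[cite: Arapura2006, Lemma 4.2] [cite: Huybrechts1999, §1.9] -/
theorem hodgeConjectureFor_powers_of_eighteen_le
    (h : FloccariFu2026_k3HilbertType_transcendentalEmbedding_isDominatedByPowers_discOneWeilFourfold)
    (hFF : FloccariFu2026_hodgeClasses_algebraic_powers_discOneWeilFourfold)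
    (h42 : Arapura2006_hodgeClasses_algebraic_of_isDominatedByPowers)
    (hSig : Huybrechts1999_k3HilbertType_transcendentalPart_signature)
    (hX : IsSmoothProjective 4 X) (hK : IsOfK3HilbertSquareType X) (hM : MarkedK3Sq[X, φ, P, z])
    (hρ : 18 ≤ Module.finrank ℂ ↥(algebraicClasses X 1)) :
    HodgeConjectureFor 4 X ∧ ∀ m : ℕ, HodgeConjectureFor ((m + 1) * 4) (X.pow (m + 1)) := by
  obtain ⟨b, T, Pol, hb, -, -, -, -, hdim, hT⟩ := exists_isTranscendentalPartHK (X := X) hX hM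
  have hrank : Module.finrank ℚ T.toSubmodule ≤ 5 := by omega
  exact hodgeConjectureFor_powers_k3HilbertType_of_finrank_transcendental_le_five h hFF h42 hSig (n := 2) le_rfl hX
    ((isOfK3HilbertSquareType_iff).1 hK) hb hT hrank

end Summit.HodgeConjecture.HodgeConjecture.Theorems.MarkmanPartnerTransport.KugaSatakeHK

end
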